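import Literature.Topology.FourManifolds.StraightLineIsotopyExtension
import Mathlib.Analysis.Calculus.InverseFunctionTheorem.ContDiff
import Mathlib.Analysis.Normed.Operator.BoundedLinearMaps
import HarnessLib

/-!
# A smooth self-map of `ℝⁿ` which is an injective immersion on a compact set is a smooth chart near it

Topic `Literature/Topology/FourManifolds`; chart bookkeeping for the smoothing of PD
homeomorphisms (Munkres, Ann. of Math. 72 (1960); the "smooth models" of a PD map on the closed
simplices of its complex, Munkres (1966), Def. 8.3 / proof of Thm. 8.4).  Let `g : E → E` be
`C^∞` on a finite-dimensional real normed space, injective on a compact set `K` and with injective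
(hence invertible) derivative at every point of `K`.  Then `g` restricts to an open partial
homeomorphism `e` of `E` with `K ⊆ e.source`, whose inverse is `C^∞` on `e.target` and whose
derivative is invertible on `e.source` (`exists_openPartialHomeomorph_of_injOn_isCompact`).
Ingredients: invertibility of the derivative is an open condition (`ContinuousLinearEquiv.isOpen`),
local injectivity and openness by the inverse function theorem, injectivity on a neighbourhood of
`K` by `exists_isOpen_injOn_of_isCompact` (`StraightLineIsotopyExtension.lean`), smoothness of the
inverse by `OpenPartialHomeomorph.contDiffAt_symm`.  Everything is proved; no definitions; no
named facts.

## References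

* J. R. Munkres, *Elementary differential topology* (1966), §8 (proof of Thm. 8.4). [Munkres1966]
* J. M. Lee, *Introduction to Smooth Manifolds* (2013), Thm. 4.5, Prop. 4.8, Prop. 5.2.
-/

noncomputable section

open Set Function Metric Filter Module
open scoped Topology ContDiff

namespace Literature.Topology.FourManifolds

variable {E : Type*} [NormedAddCommGroup E] [NormedSpace ℝ E] [FiniteDimensional ℝ E]

/-- An injective continuous linear self-map of a finite-dimensional space is (the coercion of) a
continuous linear equivalence. [folklore] -/
theorem exists_continuousLinearEquiv_eq_of_injective {A : E →L[ℝ] E} (hA : Injective A) :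
    ∃ L : E ≃L[ℝ] E, (L : E →L[ℝ] E) = A :=
  ⟨LinearEquiv.toContinuousLinearEquiv (LinearEquiv.ofInjectiveEndo A.toLinearMap hA),
    by ext v; rfl⟩

/-- The set of points where the derivative of a `C¹` map is invertible is open. [folklore] -/
theorem isOpen_setOf_exists_fderiv_eq {g : E → E} (hg : ContDiff ℝ ∞ g) :
    IsOpen {x : E | ∃ L : E ≃L[ℝ] E, (L : E →L[ℝ] E) = fderiv ℝ g x} := by
  have h : {x : E | ∃ L : E ≃L[ℝ] E, (L : E →L[ℝ] E) = fderiv ℝ g x} =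
      (fderiv ℝ g) ⁻¹' (range ((↑) : (E ≃L[ℝ] E) → E →L[ℝ] E)) := by
    ext x
    simp only [mem_setOf_eq, mem_preimage, mem_range]
  rw [h]
  exact (ContinuousLinearEquiv.isOpen (𝕜 := ℝ) (E := E) (F := E)).preimage
    (hg.continuous_fderiv (by simp))

/-- **Injective immersions of compact sets are charts nearby.** Let `g : E → E` be `C^∞`,
injective on the compact set `K`, with injective derivative at every point of `K`.  Then there is
an open partial homeomorphism `e` of `E` with `⇑e = g`, `K ⊆ e.source`, inverse `C^∞` on
`e.target`, and invertible derivative of `g` at every point of `e.source`. [folklore] -/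
theorem exists_openPartialHomeomorph_of_injOn_isCompact {g : E → E} (hg : ContDiff ℝ ∞ g)
    {K : Set E} (hK : IsCompact K) (hinj : InjOn g K)
    (hD : ∀ x ∈ K, Injective (fderiv ℝ g x)) :
    ∃ e : OpenPartialHomeomorph E E, ⇑e = g ∧ K ⊆ e.source ∧ ContDiffOn ℝ ∞ e.symm e.target ∧
      ∀ x ∈ e.source, ∃ L : E ≃L[ℝ] E, HasFDerivAt g (L : E →L[ℝ] E) x := by
  -- `U`: where the derivative is invertible
  set U : Set E := {x : E | ∃ L : E ≃L[ℝ] E, (L : E →L[ℝ] E) = fderiv ℝ g x} with hU_def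
  have hUo : IsOpen U := isOpen_setOf_exists_fderiv_eq hg
  have hKU : K ⊆ U := fun x hx => exists_continuousLinearEquiv_eq_of_injective (hD x hx)
  have hstrict : ∀ x ∈ U, ∃ L : E ≃L[ℝ] E, HasStrictFDerivAt g (L : E →L[ℝ] E) x := by
    rintro x ⟨L, hL⟩
    exact ⟨L, hL ▸ hg.contDiffAt.hasStrictFDerivAt (by simp)⟩
  -- local injectivity on `U`
  have hlocinj : ∀ x ∈ U, ∃ V ∈ 𝓝 x, InjOn g V := by
    intro x hx
    obtain ⟨L, hL⟩ := hstrict x hx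
    refine ⟨(hL.toOpenPartialHomeomorph g).source,
      (hL.toOpenPartialHomeomorph g).open_source.mem_nhds hL.mem_toOpenPartialHomeomorph_source,
      ?_⟩
    have := (hL.toOpenPartialHomeomorph g).injOn
    rwa [HasStrictFDerivAt.toOpenPartialHomeomorph_coe] at this
  -- images of open subsets of `U` are open
  have hopen : ∀ O : Set E, IsOpen O → O ⊆ U → IsOpen (g '' O) := by
    intro O hO hOU
    rw [isOpen_iff_mem_nhds]
    rintro _ ⟨x, hx, rfl⟩
    obtain ⟨L, hL⟩ := hstrict x (hOU hx)
    rw [← hL.map_nhds_eq_of_equiv, Filter.mem_map]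
    exact mem_of_superset (hO.mem_nhds hx) (subset_preimage_image g O)
  -- injectivity on an open neighbourhood of `K`
  obtain ⟨V, hVo, hKV, hinjV⟩ := exists_isOpen_injOn_of_isCompact hK
    (fun x _ => hg.continuous.continuousAt) hinj fun x hx => hlocinj x (hKU hx)
  set W : Set E := V ∩ U with hW_def
  have hWo : IsOpen W := hVo.inter hUo
  have hinjW : InjOn g W := hinjV.mono inter_subset_left
  -- the open partial homeomorphism
  set pe : PartialEquiv E E := hinjW.toPartialEquiv g W with hpe
  have hpe_coe : (pe : E → E) = g := rfl
  have hpe_source : pe.source = W := rfl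
  have hc : ContinuousOn pe pe.source := hg.continuous.continuousOn
  have ho : IsOpenMap (pe.source.restrict pe) := by
    intro O hO
    obtain ⟨t, ht, rfl⟩ := isOpen_induced_iff.1 hO
    have himg : pe.source.restrict pe '' (Subtype.val ⁻¹' t) = g '' (W ∩ t) := by
      ext y
      constructor
      · rintro ⟨⟨x, hxW⟩, hxt, rfl⟩
        exact ⟨x, ⟨hxW, hxt⟩, rfl⟩
      · rintro ⟨x, ⟨hxW, hxt⟩, rfl⟩
        exact ⟨⟨x, hxW⟩, hxt, rfl⟩
    rw [himg]
    exact hopen _ (hWo.inter ht) fun x hx => hx.1.2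
  set e : OpenPartialHomeomorph E E := OpenPartialHomeomorph.ofContinuousOpenRestrict pe hc ho hWo
    with he_def
  have he_coe : ⇑e = g := rfl
  have he_source : e.source = W := rfl
  refine ⟨e, he_coe, fun x hx => ⟨hKV hx, hKU hx⟩, ?_, fun x hx => ?_⟩
  · intro y hy
    have hx : e.symm y ∈ e.source := e.map_target hy
    obtain ⟨L, hL⟩ := hstrict (e.symm y) (he_source ▸ hx).2
    exact (e.contDiffAt_symm hy (by rw [he_coe]; exact hL.hasFDerivAt)
      (by rw [he_coe]; exact hg.contDiffAt)).contDiffWithinAt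
  · obtain ⟨L, hL⟩ := hstrict x (he_source ▸ hx).2
    exact ⟨L, hL.hasFDerivAt⟩

end Literature.Topology.FourManifolds
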